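import Mathlib
import Summits.Ventures.HodgeRepro2.T5ResidueConjugate
import Summits.Ventures.HodgeRepro2.T5QuadraticGalois
import Summits.Ventures.HodgeRepro2.T5UnramifiedNormApprox

/-!
# Residue-level norm and trace surjectivity for an unramified quadratic extension of local rings

The two residue-level hypotheses of `T5UnramifiedNormApprox` are discharged here from Mathlib's
`FiniteField.norm_surjective` / `Algebra.trace_surjective`: for local rings `R → S` with residue
fields `k ⊂ k'` of orders `q` and `q²` (the setting of `T5ResidueConjugate`, row 119) and a ring
involution `σ` of `S` fixing `R` whose fixed points are exactly `R`, the residue automorphism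
`σ̄ : k' ≃ₐ[k] k'` is the non-trivial element of `Gal(k'/k)` (a group of order 2), so that the
norm and trace of `k'/k` are `x̄ ↦ x̄ · σ̄ x̄` and `x̄ ↦ x̄ + σ̄ x̄`
(`norm_eq_mul_residueAut`, `trace_eq_add_residueAut`).  Hence every unit `u` of `R` is a norm
`x · σ x` modulo the maximal ideal (`exists_normConj_sub_mem_maximalIdeal`) and every `σ`-fixed
`c ∈ S` is a trace `t + σ t` modulo the maximal ideal (`exists_add_conj_sub_mem_maximalIdeal`);
combined with `T5UnramifiedNormApprox`, every unit of `R` is a norm modulo every power of the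
uniformiser (`exists_units_normConj_sub_dvd`).

Declaration per README §8(d): «uses an L-value-free non-vanishing device: NO».
-/

namespace Summit.Ventures.HodgeRepro2.T5UnramifiedNormResidue

open IsLocalRing T5UnramifiedNormApprox

variable {R S : Type*} [CommRing R] [CommRing S] [Algebra R S] [IsLocalRing R] (σ : S ≃+* S)
  (hσR : ∀ r : R, σ (algebraMap R S r) = algebraMap R S r)

/-- The involution `σ` as an `R`-algebra automorphism of `S`. -/
noncomputable def algEquiv : S ≃ₐ[R] S := AlgEquiv.ofRingEquiv (f := σ) hσR

omit [IsLocalRing R] in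
/-- `algEquiv` acts as `σ`. -/
theorem algEquiv_apply (x : S) : algEquiv σ hσR x = σ x := rfl

section Residue

variable [IsLocalRing S] [IsLocalHom (algebraMap R S)]

/-- The residue automorphism `σ̄ : k' ≃ₐ[k] k'` induced by `σ`. -/
noncomputable def residueAut : ResidueField S ≃ₐ[ResidueField R] ResidueField S :=
  ResidueField.mapAlgEquiv' (algEquiv σ hσR)

/-- `σ̄ (x̄) = (σ x)̄`. -/
theorem residueAut_residue (x : S) : residueAut σ hσR (residue S x) = residue S (σ x) := rfl

section FiniteResidue

variable (hσσ : ∀ s : S, σ (σ s) = s) (hfix : ∀ s : S, σ s = s → ∃ r : R, s = algebraMap R S r)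
  {q : ℕ} (hq : 2 ≤ q) (hR : Nat.card (ResidueField R) = q) (hS : Nat.card (ResidueField S) = q ^ 2)

include hq hS in
/-- The residue field of `S` is finite. -/
theorem finite_residueField_S : Finite (ResidueField S) :=
  Nat.finite_of_card_ne_zero (by rw [hS]; positivity)

include hq hR in
/-- The residue field of `R` is finite. -/
theorem finite_residueField_R : Finite (ResidueField R) :=
  Nat.finite_of_card_ne_zero (by rw [hR]; omega)

include hq hR hS in
/-- `[k' : k] = 2`. -/
theorem finrank_residueField_eq_two :
    Module.finrank (ResidueField R) (ResidueField S) = 2 := by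
  haveI := finite_residueField_S hq hS
  haveI := finite_residueField_R hq hR
  haveI : Module.Finite (ResidueField R) (ResidueField S) := Module.Finite.of_finite
  have h := Module.natCard_eq_pow_finrank (K := ResidueField R) (V := ResidueField S)
  rw [hS, hR] at h
  exact (Nat.pow_right_injective hq h).symm

include hσσ hfix hq hR hS in
/-- `σ̄ ≠ 1`: the residue of `θ − σ θ` is non-zero for `θ` not reducing into `k`. -/
theorem residueAut_ne_one : residueAut σ hσR ≠ 1 := by
  haveI := finite_residueField_S hq hS
  haveI := finite_residueField_R hq hR
  obtain ⟨θ, hθ⟩ := T5ResidueConjugate.exists_residue_notMem_range (R := R) (S := S) hq hR hS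
  have h := T5ResidueConjugate.residue_sub_conj_ne_zero σ hσσ hfix hθ
  intro h1
  apply h
  rw [map_sub, sub_eq_zero]
  have := congrArg (fun e : ResidueField S ≃ₐ[ResidueField R] ResidueField S => e (residue S θ)) h1
  simp only [residueAut_residue, AlgEquiv.one_apply] at this
  exact this.symm

include hq hR hS in
/-- `k'/k` is Galois (quadratic and separable). -/
theorem isGalois_residueField : IsGalois (ResidueField R) (ResidueField S) := by
  haveI := finite_residueField_S hq hS
  haveI := finite_residueField_R hq hR
  haveI : Module.Finite (ResidueField R) (ResidueField S) := Module.Finite.of_finite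
  exact T5QuadraticGalois.isGalois (finrank_residueField_eq_two hq hR hS)

include hσσ hfix hq hR hS in
/-- `Gal(k'/k) = {1, σ̄}`. -/
theorem univ_eq_pair [Fintype (ResidueField S ≃ₐ[ResidueField R] ResidueField S)]
    [DecidableEq (ResidueField S ≃ₐ[ResidueField R] ResidueField S)] :
    (Finset.univ : Finset (ResidueField S ≃ₐ[ResidueField R] ResidueField S)) =
      {1, residueAut σ hσR} := by
  haveI := finite_residueField_S hq hS
  haveI := finite_residueField_R hq hR
  haveI : Module.Finite (ResidueField R) (ResidueField S) := Module.Finite.of_finite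
  have hcard := T5QuadraticGalois.card_aut_eq_two (finrank_residueField_eq_two hq hR hS)
  have hne : (1 : ResidueField S ≃ₐ[ResidueField R] ResidueField S) ≠ residueAut σ hσR :=
    (residueAut_ne_one σ hσR hσσ hfix hq hR hS).symm
  symm
  apply Finset.eq_univ_of_card
  rw [Finset.card_pair hne, Fintype.card_eq_nat_card, hcard]

include hσσ hfix hq hR hS in
/-- The norm of `k'/k` is `x̄ ↦ x̄ · σ̄ x̄`. -/
theorem norm_eq_mul_residueAut (x : ResidueField S) :
    algebraMap (ResidueField R) (ResidueField S) (Algebra.norm (ResidueField R) x) =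
      x * residueAut σ hσR x := by
  haveI := finite_residueField_S hq hS
  haveI := finite_residueField_R hq hR
  haveI : Module.Finite (ResidueField R) (ResidueField S) := Module.Finite.of_finite
  haveI := isGalois_residueField hq hR hS
  classical
  rw [Algebra.norm_eq_prod_automorphisms, univ_eq_pair σ hσR hσσ hfix hq hR hS,
    Finset.prod_pair (residueAut_ne_one σ hσR hσσ hfix hq hR hS).symm, AlgEquiv.one_apply]

include hσσ hfix hq hR hS in
/-- The trace of `k'/k` is `x̄ ↦ x̄ + σ̄ x̄`. -/
theorem trace_eq_add_residueAut (x : ResidueField S) :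
    algebraMap (ResidueField R) (ResidueField S) (Algebra.trace (ResidueField R) (ResidueField S) x) =
      x + residueAut σ hσR x := by
  haveI := finite_residueField_S hq hS
  haveI := finite_residueField_R hq hR
  haveI : Module.Finite (ResidueField R) (ResidueField S) := Module.Finite.of_finite
  haveI := isGalois_residueField hq hR hS
  classical
  rw [trace_eq_sum_automorphisms, univ_eq_pair σ hσR hσσ hfix hq hR hS,
    Finset.sum_pair (residueAut_ne_one σ hσR hσσ hfix hq hR hS).symm, AlgEquiv.one_apply]

include hσR hσσ hfix hq hR hS in
/-- RESIDUE-LEVEL NORM SURJECTIVITY: every unit `u` of `R` is `x · σ x` modulo the maximal ideal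
of `S`, for a unit `x` of `S`. -/
theorem exists_normConj_sub_mem_maximalIdeal (u : R) (hu : IsUnit u) :
    ∃ x : Sˣ, normConj σ (x : S) - algebraMap R S u ∈ maximalIdeal S := by
  haveI := finite_residueField_S hq hS
  haveI := finite_residueField_R hq hR
  haveI : Module.Finite (ResidueField R) (ResidueField S) := Module.Finite.of_finite
  obtain ⟨y, hy⟩ := FiniteField.norm_surjective (ResidueField R) (ResidueField S) (residue R u)
  obtain ⟨x, rfl⟩ := residue_surjective y
  have hx : IsUnit x := by
    rw [← residue_ne_zero_iff_isUnit]
    intro h0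
    have h1 := congrArg (algebraMap (ResidueField R) (ResidueField S)) hy
    rw [norm_eq_mul_residueAut σ hσR hσσ hfix hq hR hS, h0, zero_mul,
      ResidueField.algebraMap_residue] at h1
    have h2 : residue S (algebraMap R S u) ≠ 0 := by
      rw [residue_ne_zero_iff_isUnit]; exact hu.map _
    exact h2 h1.symm
  refine ⟨hx.unit, ?_⟩
  rw [← residue_eq_zero_iff, map_sub, sub_eq_zero, IsUnit.unit_spec, normConj_apply, map_mul,
    ← residueAut_residue σ hσR, ← norm_eq_mul_residueAut σ hσR hσσ hfix hq hR hS, hy,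
    ResidueField.algebraMap_residue]

include hσR hσσ hfix hq hR hS in
/-- RESIDUE-LEVEL TRACE SURJECTIVITY: every `σ`-fixed `c ∈ S` is `t + σ t` modulo the maximal
ideal of `S`. -/
theorem exists_add_conj_sub_mem_maximalIdeal (c : S) (hc : σ c = c) :
    ∃ t : S, (t + σ t) - c ∈ maximalIdeal S := by
  haveI := finite_residueField_S hq hS
  haveI := finite_residueField_R hq hR
  haveI : Module.Finite (ResidueField R) (ResidueField S) := Module.Finite.of_finite
  obtain ⟨r, hr⟩ := hfix c hc
  obtain ⟨y, hy⟩ := Algebra.trace_surjective (ResidueField R) (ResidueField S) (residue R r)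
  obtain ⟨t, rfl⟩ := residue_surjective y
  refine ⟨t, ?_⟩
  rw [← residue_eq_zero_iff, map_sub, sub_eq_zero, map_add, ← residueAut_residue σ hσR,
    ← trace_eq_add_residueAut σ hσR hσσ hfix hq hR hS, hy, ResidueField.algebraMap_residue, hr]

end FiniteResidue

end Residue

section DVR

variable [IsDomain S] [IsDiscreteValuationRing S] [IsLocalHom (algebraMap R S)]

/-- In the DVR `S` with uniformiser `ϖ`, membership in the maximal ideal is divisibility by `ϖ`. -/
theorem mem_maximalIdeal_iff_dvd {ϖ : S} (hϖ : Irreducible ϖ) (s : S) :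
    s ∈ maximalIdeal S ↔ ϖ ∣ s := by
  rw [hϖ.maximalIdeal_eq, Ideal.mem_span_singleton]

variable (hσσ : ∀ s : S, σ (σ s) = s) (hfix : ∀ s : S, σ s = s → ∃ r : R, s = algebraMap R S r)
  {q : ℕ} (hq : 2 ≤ q) (hR : Nat.card (ResidueField R) = q) (hS : Nat.card (ResidueField S) = q ^ 2)

include hσR hσσ hfix hq hR hS in
/-- EVERY UNIT OF `R` IS A NORM MODULO EVERY POWER OF THE UNIFORMISER: for `ϖ ∈ R` with
`algebraMap R S ϖ` irreducible in `S` (the unramified case) and every unit `u` of `R`, for every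
`n ≥ 1` there is a unit `x` of `S` with `x · σ x ≡ u (mod ϖ^n)`. -/
theorem exists_units_normConj_sub_dvd {ϖ : R} (hϖS : Irreducible (algebraMap R S ϖ))
    (u : R) (hu : IsUnit u) :
    ∀ n : ℕ, 1 ≤ n → ∃ x : Sˣ, (algebraMap R S ϖ) ^ n ∣ normConj σ (x : S) - algebraMap R S u := by
  have hϖfix : σ (algebraMap R S ϖ) = algebraMap R S ϖ := hσR ϖ
  have hϖ0 : algebraMap R S ϖ ≠ 0 := hϖS.ne_zero
  have hϖm : algebraMap R S ϖ ∈ maximalIdeal S := by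
    rw [hϖS.maximalIdeal_eq]; exact Ideal.mem_span_singleton_self _
  refine T5UnramifiedNormApprox.exists_units_normConj_sub_dvd σ hσσ hϖfix hϖ0 hϖm ?_ (hσR u) ?_
  · intro c hc
    obtain ⟨t, ht⟩ := exists_add_conj_sub_mem_maximalIdeal σ hσR hσσ hfix hq hR hS c hc
    exact ⟨t, (mem_maximalIdeal_iff_dvd hϖS _).mp ht⟩
  · obtain ⟨x, hx⟩ := exists_normConj_sub_mem_maximalIdeal σ hσR hσσ hfix hq hR hS u hu
    exact ⟨x, (mem_maximalIdeal_iff_dvd hϖS _).mp hx⟩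

end DVR

end Summit.Ventures.HodgeRepro2.T5UnramifiedNormResidue
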